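import Summits.CriticalPhenomena.PercolationContinuityZ3.Theorems.PercNearOneGluingNoHeavyQuantResidSiblingTail
import HarnessLib

/-!
# QUANT lane R8, T-DEC: THE RESIDUAL RECURSION — peeling a sibling whose root gate dominates the compound: the gated forest (and the residual
# of the root-scaled expansion) is an EXACT two-term mixture of (scaled tree) ∗ (the smaller list's residual) and arm-1 g47's U-PART law
# in the heavy-single orientation (arm-1 gen 52, architect)

builds on p205010 (kernel theorem, internal audit signed; external expert review pending)

Support file (`--supports stmt-CriticalPhenomena-4575`), QUANT lane seat prim-quant-arm-1 (gen 52, architect), rung R8 of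
`run/shared/lean/prim/quant/LADDER.md`; memo `run/shared/lean/prim/quant/prim-quant-arm-1-g52/ARCH-G52.md` §3.1.  Theorems only (the opened
compound `H = (G − (1−q)δ₀)/q` — g47's `gate_{fQ/q}(fbeta)` written without `fQ` — is spelled inline), standard axioms, no sorries.
Uses the root-scaled expansion (`…QuantRootScaledExpansion`: `Sib.scale`, `wco`, `resid`, `gate_flaw_eq_mix`, `flaw_map_scale_cons`) and arm-1 g45's
two-root identity (`twoRoot_gateCoupling`).

THE IDENTITY (ARCH-G52 §3.1, checked first in exact arithmetic: 0 / 60 mismatches on random lists).  For a sibling `s = (q, ρ)` in front of a list `L′`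
(`G = flaw L′`, `Gᵃ = flaw L′ₐ`, `t = gate ρ q`, `tᵃ = gate ρ (a q)`, `r = rfac a s = (1−q)/(1−aq)`) and ANY weight `w′ < 1`:
  `gate (flaw (s :: L′)) a − r·w′·flaw ((s :: L′)ₐ) = r(1−w′)·[tᵃ ∗ resid a w′ L′] + (1−r)·gate_{aq}(ρ ∗ H)`,  `H = (G − (1−q)δ₀)/q`,
an identity of rational functions in the sense of `twoRoot_gateCoupling`: the compound `G` IS `gate_q H`, so `s :: L′` is a two-root forest with EQUAL root gates
`q, q`, and the (P)-part `tᵃ ∗ gate_a G` splits again by the expansion `gate_a G = w′ Gᵃ + (1−w′) resid a w′ L′` (`gate_flaw_eq_mix`), whose product piece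
`tᵃ ∗ Gᵃ = flaw((s :: L′)ₐ)` is exactly what the left side subtracts.  `H` is a law iff `flaw L′ 0 ≥ 1 − q` (the single's gate dominates the compound's
"some root open" probability — the HEAVY-SINGLE orientation; the other orientation is arm-1 g47's compound cut `…QuantCompoundCut`).  With `w′ = wco a L′` and
`r·wco a L′ = wco a (s :: L′)` (any `s` whose root gate is at least the least gate of `L′`) the left side is `(1 − wco)·resid` of `s :: L′`:
**`(1 − w)·R_{s::L′} = (r − w)·[tᵃ ∗ R_{L′}] + (1 − r)·U_s`** (`resid_cons_recursion`).  CONSEQUENCE (memo §3): since `tᵃ ∗ R_{L′}` is DEC by `convClosedT_holds`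
whenever `R_{L′}` is, the open content of `LightResidDECOracle` (and, one level up, of the sibling step) is the DEC of the U-parts `gate_{aq}(ρ ∗ H)` — for width 3
with a balanced light pair these are mixtures of oracle-legal forests (`…QuantThreeRootHeavySingleStep/Oracle`).

* `gate_openedCompound` (`gate H q = G` for `H = fun h => (G h − (1 − q)·[h = 0]) / q`, `q ≠ 0`), `openedCompound_eq_zero`;
* **`gate_flaw_cons_eq_recursion`** (any `w′ < 1`);  **`resid_cons_recursion`** (the canonical form, hypothesis `wco a (s :: L′) = rfac a s · wco a L′`);
* `wco_cons_eq_rfac_mul` — that hypothesis holds whenever `rfac a s ≤ rfac a t` for some… stated in the usable form: `rfac a s · wco a L′ ≤ rprod a L′`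
  (e.g. `s.q ≥ t.q` for the least gate `t` of `L′`) ⟹ `wco a (s :: L′) = rfac a s · wco a L′`.

HONEST STATUS: exact algebra, not a proof of the node; `LightResidDECOracle`, `LightResidDEC`, `LightSiblingStep`, `FarTreeRow` OPEN; RATE class log\* / honest
sentence of `run/shared/lean/prim/quant/README.md` unchanged.  [this work]; two-root identity: prim-quant-arm-1 g45; U-part: arm-1 g47; expansion: arm-1 g48.
Nothing here is cited as a published result.  The gluing rows served [cite: KozmaNitzan2024, Conjecture 3 (p. 15)]; product measure [cite: Grimmett1999, §1.3 p. 10].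
-/

noncomputable section

open scoped BigOperators

namespace Summit.CriticalPhenomena.PercolationContinuityZ3.Theorems
namespace Quant
namespace LawDec

open Finset

/-- **the compound law with a root gate of strength `q` OPENED** is `H = (G − (1−q)·δ₀)/q` (written inline below; g47's `gate_{fQ/q}(fbeta)`):
`gate H q = G` (`q ≠ 0`). [this work] -/
theorem gate_openedCompound (q : ℝ) (G : ℕ → ℝ) (hq : q ≠ 0) :
    gate (fun k => (G k - (1 - q) * (if k = 0 then (1 : ℝ) else 0)) / q) q = G := by
  funext h
  rw [gate_apply]
  field_simp
  ring

/-- the opened compound vanishes above the compound's top. [this work] -/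
theorem openedCompound_eq_zero (q : ℝ) (G : ℕ → ℝ) (M : ℕ) (hG : ∀ h, M < h → G h = 0) (h : ℕ) (hh : M < h) :
    (fun k => (G k - (1 - q) * (if k = 0 then (1 : ℝ) else 0)) / q) h = 0 := by
  show (G h - (1 - q) * (if h = 0 then (1 : ℝ) else 0)) / q = 0
  rw [hG h hh, if_neg (by omega)]
  ring

/-- **THE RECURSION IDENTITY (any weight `w′ < 1`)**: for a law-OK sibling `s` in front of a law-OK list `L′`, `0 < a ≤ 1`:
`gate (flaw (s :: L′)) a h − rfac a s · w′ · flaw ((s :: L′)ₐ) h = rfac a s·(1 − w′)·(tᵃ ∗ resid a w′ L′) h + (1 − rfac a s)·gate_{a q}(ρ ∗ H) h`,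
`H k = (flaw L′ k − (1 − s.q)·[k = 0]) / s.q`; convolutions written hub-first, `lconv s.M (ftop L′)`. [this work] -/
theorem gate_flaw_cons_eq_recursion {a w' : ℝ} (ha0 : 0 < a) (ha1 : a ≤ 1) (s : Sib) (L' : List Sib) (hs : s.LawOK)
    (hL' : ∀ u ∈ L', u.LawOK) (hw' : w' < 1) (h : ℕ) :
    gate (flaw (s :: L')) a h - rfac a s * w' * flaw ((s :: L').map (Sib.scale a)) h
      = rfac a s * (1 - w') * lconv s.M (ftop L') (gate s.ρ (a * s.q)) (resid a w' L') h
        + (1 - rfac a s) * gate (lconv s.M (ftop L') s.ρ ((fun k => (flaw L' k - (1 - s.q) * (if k = 0 then (1 : ℝ) else 0)) / s.q))) (a * s.q) h := by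
  obtain ⟨hq0, hq1, _, ρM, _⟩ := hs
  obtain ⟨_, fM, _, _⟩ := flaw_facts L' hL'
  have haq : a * s.q < 1 := by nlinarith
  set H : ℕ → ℝ := (fun k => (flaw L' k - (1 - s.q) * (if k = 0 then (1 : ℝ) else 0)) / s.q) with hH
  have HM : ∀ k, ftop L' < k → H k = 0 := fun k hk => openedCompound_eq_zero s.q (flaw L') (ftop L') fM k hk
  -- the forest `s :: L′` is the two-root forest `gate ρ q ∗ gate H q`, hub first
  have eF : flaw (s :: L') = lconv s.M (ftop L') (gate s.ρ s.q) (gate H s.q) := by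
    show lconv (ftop L') s.M (flaw L') (gate s.ρ s.q) = _
    rw [lconv_comm, gate_openedCompound s.q (flaw L') hq0.ne']
  -- the scaled forest is `tᵃ ∗ Gᵃ`, hub first
  have eFa : flaw ((s :: L').map (Sib.scale a)) h = lconv s.M (ftop L') (gate s.ρ (a * s.q)) (flaw (L'.map (Sib.scale a))) h := by
    rw [flaw_map_scale_cons, lconv_comm]
  -- g45's two-root identity with equal root gates `q, q`
  have two := twoRoot_gateCoupling s.M (ftop L') s.ρ H s.q s.q a ρM HM hq0.ne' (by linarith) h
  -- the hub-gated compound is the outer-gated compound, which expands at the weight `w′`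
  have eG : gate H (a * s.q) = fun k => w' * flaw (L'.map (Sib.scale a)) k + (1 - w') * resid a w' L' k := by
    rw [← gate_gate H s.q a, gate_openedCompound s.q (flaw L') hq0.ne']
    funext k
    exact gate_flaw_eq_mix a w' L' hw' k
  have e1 : gate H (s.q / s.q) = H := by rw [div_self hq0.ne', gate_one]
  rw [eF, two, eG, lconv_lin_right, e1, eFa, rfac]
  ring

/-- the weight of a list with a head whose ratio is dominated: `rfac a s · wco a (t :: L″) ≤ rprod a (t :: L″)` ⟹
`wco a (s :: t :: L″) = rfac a s · wco a (t :: L″)` (e.g. when `s.q ≥` the least root gate of the tail). [this work] -/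
theorem wco_cons_eq_rfac_mul (a : ℝ) (s t : Sib) (L₂ : List Sib) (hle : rfac a s * wco a (t :: L₂) ≤ rprod a (t :: L₂)) :
    wco a (s :: t :: L₂) = rfac a s * wco a (t :: L₂) := by
  show min (rprod a (t :: L₂)) (rfac a s * wco a (t :: L₂)) = _
  exact min_eq_right hle

/-- the head version of the domination hypothesis: if the SECOND sibling's root gate is at most the first's, then
`rfac a s · wco a (t :: L″) ≤ rprod a (t :: L″)` (`0 ≤ a ≤ 1`, law-OK data). [this work] -/
theorem rfac_mul_wco_le_rprod {a : ℝ} (ha0 : 0 ≤ a) (ha1 : a ≤ 1) (s t : Sib) (L₂ : List Sib) (hs : s.LawOK)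
    (hL : ∀ u ∈ t :: L₂, u.LawOK) (hq : t.q ≤ s.q) : rfac a s * wco a (t :: L₂) ≤ rprod a (t :: L₂) := by
  have ht := hL t List.mem_cons_self
  have hst : rfac a s ≤ rfac a t := rfac_le_rfac_of_le ha0 ha1 hs ht hq
  obtain ⟨hW0, _, _⟩ := wco_facts ha1 (t :: L₂) hL
  have hWP : wco a (t :: L₂) ≤ rprod a L₂ := by
    rcases L₂ with _ | ⟨u, L₃⟩
    · simp [wco, rprod]
    · exact (wco_cons_cons_le a t u L₃).1
  show rfac a s * wco a (t :: L₂) ≤ rfac a t * rprod a L₂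
  exact mul_le_mul hst hWP hW0.le (rfac_facts ha1 ht).1.le

/-- **THE RESIDUAL RECURSION (canonical weights)**: law-OK `s :: L′` (`L′` with `≥ 2` members so that `wco a L′ < 1`), `0 < a < 1`, and
`wco a (s :: L′) = rfac a s · wco a L′`:  `(1 − w)·R_{s::L′} h = (rfac a s − w)·(tᵃ ∗ R_{L′}) h + (1 − rfac a s)·gate_{a q}(ρ ∗ H) h`,
`w = wco a (s :: L′)`, `R_· = resid a (wco a ·) ·`, `H k = (flaw L′ k − (1 − s.q)·[k = 0]) / s.q`. [this work] -/
theorem resid_cons_recursion {a : ℝ} (ha0 : 0 < a) (ha1 : a < 1) (s t u : Sib) (L₂ : List Sib) (hs : s.LawOK)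
    (hL' : ∀ v ∈ t :: u :: L₂, v.LawOK) (hwco : wco a (s :: t :: u :: L₂) = rfac a s * wco a (t :: u :: L₂)) (h : ℕ) :
    (1 - wco a (s :: t :: u :: L₂)) * resid a (wco a (s :: t :: u :: L₂)) (s :: t :: u :: L₂) h
      = (rfac a s - wco a (s :: t :: u :: L₂)) *
          lconv s.M (ftop (t :: u :: L₂)) (gate s.ρ (a * s.q)) (resid a (wco a (t :: u :: L₂)) (t :: u :: L₂)) h
        + (1 - rfac a s) * gate (lconv s.M (ftop (t :: u :: L₂)) s.ρ ((fun k => (flaw (t :: u :: L₂) k - (1 - s.q) * (if k = 0 then (1 : ℝ) else 0)) / s.q))) (a * s.q) h := by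
  have hw'1 : wco a (t :: u :: L₂) < 1 := wco_lt_one ha1 t u L₂ hL'
  have hsL : ∀ v ∈ s :: t :: u :: L₂, v.LawOK := by
    intro v hv
    rcases List.mem_cons.1 hv with rfl | hv'
    · exact hs
    · exact hL' v hv'
  have hw1 : wco a (s :: t :: u :: L₂) < 1 := wco_lt_one ha1 s t (u :: L₂) hsL
  have eres : (1 - wco a (s :: t :: u :: L₂)) * resid a (wco a (s :: t :: u :: L₂)) (s :: t :: u :: L₂) h
      = gate (flaw (s :: t :: u :: L₂)) a h
        - wco a (s :: t :: u :: L₂) * flaw ((s :: t :: u :: L₂).map (Sib.scale a)) h := by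
    have hne : 1 - wco a (s :: t :: u :: L₂) ≠ 0 := by linarith
    simp only [resid]
    field_simp
  have key := gate_flaw_cons_eq_recursion ha0 ha1.le s (t :: u :: L₂) hs hL' hw'1 h
  rw [eres, hwco]
  rw [show rfac a s * wco a (t :: u :: L₂) * flaw (List.map (Sib.scale a) (s :: t :: u :: L₂)) h
      = rfac a s * wco a (t :: u :: L₂) * flaw ((s :: t :: u :: L₂).map (Sib.scale a)) h from rfl] at *
  rw [key]
  ring

end LawDec
end Quant
end Summit.CriticalPhenomena.PercolationContinuityZ3.Theorems
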